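import Literature.IUT.HodgeTheaters.TemperedCoveringsProp2122Sub
import Literature.IUT.HodgeTheaters.TemperedCoveringsNodNonAt
import HarnessLib

/-!
# [IUTchI] Prop. 2.2 AS TYPED from Prop. 2.1 for `𝔾` and for `ℍ`, with [SemiAnbd] Thm 3.7 (iii) AT THE TWO GRAPHS

Mochizuki, *Inter-universal Teichmüller theory I*, kurims manuscript (May 2020), §2, Proposition 2.2,
pp. 45–46 [cite: Mochizuki2012, Prop 2.2 pp.45-46] (D-0012 claim key; series status DISPUTED; nothing of
the series is asserted here).

PROOF-ONLY companion (abc-iut cell, φ2-consumers programme, L5 block «φ2-L5» item L5d, seat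
abc-iut-L3-d1) of `TemperedCoveringsProp2122Sub.lean` (abc-iut-w5-d028): the SAME proof of
`prop22_byName`, with the ∀-countable named fact `ProfiniteSemiGraph.CompactInVerticial` ([SemiAnbd] Thm
3.7 (iii), F-1732) — which the original instantiates at TWO graphs, the dual semi-graph `𝒢` of the `𝔾`-datum
and `𝒢H` of the `ℍ`-datum `D.restrictH hcH` — replaced by ONE per-graph hypothesis for each:
`(hCV : CompactInVerticialAt 𝒢)`, `(hCVH : CompactInVerticialAt 𝒢H)` (two-graph rule of the programme),
routed through `prop21_byName_at` (item L5c).  Everything else verbatim; the original is untouched (its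
sub-node lemmas `prop22_of_prop21_of_prop21H`, `restrictH`, … are reused by name).  Typed ≠ proved;
nothing here bears on [IUTchIII] Cor. 3.12.
-/

namespace Literature.IUT.HodgeTheaters

open Pointwise Topology
open Literature.AnabelianGeometry.SemiGraphs (IsProfiniteCompletion PSCDatum ProfiniteSemiGraph)
open Literature.AnabelianGeometry.SemiGraphs.ProfiniteSemiGraph (TemperedPiChart verticialSubgroups
  CompactInVerticialAt VerticialInjective)
open Literature.AnabelianGeometry.AbsoluteAnabelian (IsCommensurablyTerminal)

universe u

namespace TemperedGraphGroupData

variable (D : TemperedGraphGroupData.{u}) {𝒢 𝒢H : ProfiniteSemiGraph.{u}}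

/-- **[IUTchI] Proposition 2.2 AS TYPED with EVERY printed input BY NAME, Thm 3.7 (iii) AT the two graphs
`𝒢` (the `𝔾`-datum) and `𝒢H` (the `ℍ`-datum)** — the four clauses `CommensuratorsOfDecompositionSubgroups`
from `prop21_byName_at` for `D` and for `D.restrictH hcH`, the infinite compact verticial subgroups, density of
`Π^tp_ℍ` in `Π̂_ℍ`, and the one cited input `hHatH`, exactly as in the original.  φ2 twin of
`prop22_byName`. ([IUTchI] Prop 2.2 pp.45–46) [claim: Mochizuki2012, status: disputed] -/
theorem prop22_byName_at [T2Space D.Tp] (hcH : IsClosed (D.HatH : Set D.Hat))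
    -- the `𝔾`-datum, as in `prop21_byName`
    (c : TemperedPiChart 𝒢) (e : D.Tp ≃ₜ* c.G) (h𝒢 : 𝒢.Thm37Hypotheses)
    (hCV : CompactInVerticialAt 𝒢) (hVI : VerticialInjective.{u})
    (hPC : IsProfiniteCompletion
      ({ toMonoidHom := D.ι, continuous_toFun := D.ι_continuous } : D.Tp →ₜ* D.Hat))
    (hGal : ∀ S : ProfiniteSemiGraph.BTempCat 𝒢,
      Literature.AlgebraicGeometry.Frobenioids.IsConnectedObj S →
      ∃ (H : ProfiniteSemiGraph.BTempCat 𝒢) (_ : H ⟶ S),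
        Literature.AnabelianGeometry.SemiGraphs.IsGaloisObj H ∧
          Group.ResiduallyFinite (CategoryTheory.Aut H))
    (G : PSCDatum D.Hat) (hNN : G.VerticialIntersectionNear) (σ : 𝒢.graph.Vertex ≃ G.graph.V)
    (Λv : G.graph.V → Subgroup D.Tp)
    (hvert : ∀ v : 𝒢.graph.Vertex, (Λv (σ v)).map (e : D.Tp →* c.G) ∈ verticialSubgroups c v)
    (hΛv : ∀ v, (Λv v).map D.ι = G.vertGp v)
    (src tgt : G.graph.N → G.graph.V) (c₁ c₂ : G.graph.N → D.Tp)
    (hends : ∀ e, G.graph.nodeEnds e = s(src e, tgt e))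
    (h₁ : ∀ e, G.nodeGp e ≤ MulAut.conj (D.ι (c₁ e)) • G.vertGp (src e))
    (h₂ : ∀ e, G.nodeGp e ≤ MulAut.conj (D.ι (c₂ e)) • G.vertGp (tgt e))
    (hloop : ∀ e, src e = tgt e → (c₁ e)⁻¹ * c₂ e ∉ Λv (src e))
    -- the `ℍ`-datum `D.restrictH hcH`, likewise
    (cH : TemperedPiChart 𝒢H) (eH : (D.restrictH hcH).Tp ≃ₜ* cH.G) (h𝒢H : 𝒢H.Thm37Hypotheses)
    (hCVH : CompactInVerticialAt 𝒢H)
    (hPCH : IsProfiniteCompletion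
      ({ toMonoidHom := (D.restrictH hcH).ι, continuous_toFun := (D.restrictH hcH).ι_continuous } :
        (D.restrictH hcH).Tp →ₜ* (D.restrictH hcH).Hat))
    (hGalH : ∀ S : ProfiniteSemiGraph.BTempCat 𝒢H,
      Literature.AlgebraicGeometry.Frobenioids.IsConnectedObj S →
      ∃ (H : ProfiniteSemiGraph.BTempCat 𝒢H) (_ : H ⟶ S),
        Literature.AnabelianGeometry.SemiGraphs.IsGaloisObj H ∧
          Group.ResiduallyFinite (CategoryTheory.Aut H))
    (GH : PSCDatum (D.restrictH hcH).Hat) (hNNH : GH.VerticialIntersectionNear)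
    (σH : 𝒢H.graph.Vertex ≃ GH.graph.V)
    (ΛvH : GH.graph.V → Subgroup (D.restrictH hcH).Tp)
    (hvertH : ∀ v : 𝒢H.graph.Vertex,
      (ΛvH (σH v)).map (eH : (D.restrictH hcH).Tp →* cH.G) ∈ verticialSubgroups cH v)
    (hΛvH : ∀ v, (ΛvH v).map (D.restrictH hcH).ι = GH.vertGp v)
    (srcH tgtH : GH.graph.N → GH.graph.V) (c₁H c₂H : GH.graph.N → (D.restrictH hcH).Tp)
    (hendsH : ∀ e, GH.graph.nodeEnds e = s(srcH e, tgtH e))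
    (h₁H : ∀ e, GH.nodeGp e ≤ MulAut.conj ((D.restrictH hcH).ι (c₁H e)) • GH.vertGp (srcH e))
    (h₂H : ∀ e, GH.nodeGp e ≤ MulAut.conj ((D.restrictH hcH).ι (c₂H e)) • GH.vertGp (tgtH e))
    (hloopH : ∀ e, srcH e = tgtH e → (c₁H e)⁻¹ * c₂H e ∉ ΛvH (srcH e))
    -- the one cited input
    (hHatH : IsCommensurablyTerminal D.HatH) :
    D.CommensuratorsOfDecompositionSubgroups := by
  have h21 : D.ProfiniteConjugatesOfCompactSubgroups :=
    D.prop21_byName_at c e h𝒢 hCV hPC hGal G hNN σ Λv hvert hΛv src tgt c₁ c₂ hends h₁ h₂ hloop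
  have h21H : (D.restrictH hcH).ProfiniteConjugatesOfCompactSubgroups :=
    (D.restrictH hcH).prop21_byName_at cH eH h𝒢H hCVH hPCH hGalH GH hNNH σH ΛvH hvertH hΛvH srcH tgtH
      c₁H c₂H hendsH h₁H h₂H hloopH
  obtain ⟨v₀, hv₀c, hv₀inf⟩ :=
    D.exists_infinite_compact_of_chart c e h𝒢 hVI (fun v => Λv (σ v)) hvert
  obtain ⟨w₀, hw₀c, hw₀inf⟩ :=
    (D.restrictH hcH).exists_infinite_compact_of_chart cH eH h𝒢H hVI (fun v => ΛvH (σH v)) hvertH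
  exact D.prop22_of_prop21_of_prop21H hcH h21 ⟨_, hv₀c, hv₀inf⟩ h21H ⟨_, hw₀c, hw₀inf⟩
    hPCH.denseRange hHatH

end TemperedGraphGroupData

end Literature.IUT.HodgeTheaters
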